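import Summits.CriticalPhenomena.SAWScalingLimit.Theorems.CriticalBubbleBound.Negative.CriticalBubbleBoundProvedWindow
import Summits.CriticalPhenomena.SAWScalingLimit.Theorems.CriticalBubbleBound.Negative.CriticalBubbleBoundOneNumber
import Summits.CriticalPhenomena.SAWScalingLimit.Theorems.SAWTotalPositivityCriticalBubbleBoundDockingInjection
import Summits.CriticalPhenomena.SAWScalingLimit.Theorems.SAWTotalPositivityCriticalBubbleBoundLedgerBootstrap

/-!
# Line `docking-census-joining` — skeleton for the crux `SAWTotalPositivity.CriticalBubbleBound`
(crux item stmt-CriticalPhenomena-7117, route `route-CriticalPhenomena-SAWTotalPositivity`)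

LEAD'S COPY (prover-line-stmt-CriticalPhenomena-7117-0; `work/CriticalBubbleBound.lean`, re-published to
`Lines/docking-census-joining.lean` after every reshape).

STATUS (2026-08-16T03:00Z):
* objects LANDED — `Theorems/SAWTotalPositivityCriticalBubbleBoundDockingDefs.lean` (p72934; namespace
  `…Theorems.CriticalBubbleBound.Docking`, opened below): `term`, `block`, `blockMass`, `verts`, `pedges`,
  `rootEdge`, `shift`, `dockings`, `pinches`, `dockMass`, `pinchMass`;
* S1 `stub_dockingInjection` LANDED — `…DockingInjection.lean` p76255 (helpers `…DockingFlip.lean` p75413,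
  `…DockingTracks.lean` p75412): `∀ i, dockMass i ≤ x_c⁻¹ · pinchMass i`;
* S4 `stub_ledgerBootstrap` LANDED — `…LedgerBootstrap.lean` p73905 (reshape r1: inline block sums);
* S2 `stub_dockingEntropy` (κ₀ = 5/8) OPEN, S3 `stub_pinchRarity` (π₀ = 1/2) OPEN — the only sorries left;
* composition `CriticalBubbleBound_of_stubs : S2 → S3 → CriticalBubbleBound` PROVED below (and filed for the
  tree as `Docking.criticalBubbleBound_of_dockingEntropy_of_pinchRarity`, Theorems/…DockingReduction.lean,
  with S2/S3 as `@[conjecture]` obligation nodes).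

THE LINE (rooted dyadic-block normalisation `R_i := Σ_{n ∈ [2^i,2^{i+1})} t_n`, `t_n = c_n(0,e₀) x_c^n`;
crux ⟺ `Σ_n t_n < ∞` by the landed one-number normal form): S4 at `(κ,π,s) = (5/8,1/2,-1/16)` fed with the
Hammersley–Welsh a-priori bound (`Negative.hw_term_upper_bound`), the injection S1 (`K₁ = x_c⁻¹`), docking
entropy S2 and pinch rarity S3 gives `R_i ≤ C 2^{-i/16}`; dyadic regrouping in `ℝ≥0∞` and
`Negative.criticalBubbleBound_iff_bubble_e₀_ne_top` close. Heuristic values (Duplantier–Saleur network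
exponents / des Cloizeaux contact exponent): `κ' = 13/16`, `π' = 11/16`, so each open stub keeps 3/16 of slack.

Disproof.lean (cdisprove gen 4) honoured: §7/§10 normal form used verbatim; §4 fugacity load-bearing (all at
`x_c`); §6 endpoint never freed; §14 self-avoidance used in S1's unflip; §16 `hw_term_upper_bound` is S4's
a-priori input; §17 (boundary ≠ bulk, memoryless) not engaged — the line works with the bulk rooted series.
-/

noncomputable section

open MeasureTheory Filter Topology Set Function
open Literature.Probability.LatticeModels Literature.Probability.Percolation
open Literature.Probability.RandomPlanarGeometry Literature.Probability.RandomPlanarGeometry.SAW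
open scoped ENNReal NNReal BigOperators
open Summit.CriticalPhenomena.SAWScalingLimit.Theorems.CriticalBubbleBound.Negative

namespace Summit.CriticalPhenomena.SAWScalingLimit.Cruxes.CriticalBubbleBound.DockingCensusJoining

open Summit.CriticalPhenomena.SAWScalingLimit.Theorems.CriticalBubbleBound.Docking

/-! ## The two open exponent statements of the line (named conjectures) -/

/-- **Docking entropy with exponent `κ`** (line conjecture of `docking-census-joining`, crux
stmt-CriticalPhenomena-7117; the CONSTRUCTIVE half of the joining ledger `θ - 1 = κ + π`): for all
large `i`, `c · 2^{(κ-1) i} · R_i² ≤ dockMass i`, i.e. two independent rooted critical polygons of dyadic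
size `2^i` admit on `x_c`-average at least `c (2^i)^{κ-1}` root-edge plaquette dockings (class level:
`≳ n^κ`). Filed at `κ = 5/8`; heuristic value `13/16` from the polymer network exponents
`σ_L = (2-L)(9L+2)/64` (two two-leg vertices fused into one four-leg vertex: `n · n^{σ₄ - 2σ₂} =
n^{-3/16}` in rooted normalisation). Open: proved docking bounds use extremal rows or Madras's side
surgery only. [cite: DuplantierSaleur1986, eq. (3) (network exponents σ_L)] -/
def DockingEntropy (κ : ℝ) : Prop :=
  ∃ c : ℝ, 0 < c ∧ ∃ i₀ : ℕ, ∀ i : ℕ, i₀ ≤ i →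
    c * (2 : ℝ) ^ ((κ - 1) * (i : ℝ)) * blockMass term i ^ 2 ≤ dockMass i

/-- **Pinch rarity with exponent `π`** (line conjecture of `docking-census-joining`, crux
stmt-CriticalPhenomena-7117; the RESTRICTIVE half of the ledger): `pinchMass i ≤ C (i+1)^b 2^{-π i}
R_{i+1} + C 2^{-4i}` — a rooted critical polygon of size `≍ 2^{i+1}` carries on `x_c`-average at most
`≍ (i+1)^b 2^{-π i}` plaquettes whose flip splits it into two polygons of size `≥ 2^i + 1` each (the
absolutely summable tail accommodates Hammond-type `μ^{-n}` sparsity). Filed at `π = 1/2`; heuristic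
value `11/16` (interior-contact exponent `ν(2 + θ₂) = 43/16` against `n²` pairs). Open: the only
proved sparsity is `π = 0` for GLOBAL join plaquettes (Hammond 2018, Prop. 4.5; no tool for local /
fjord pinches). [cite: Hammond2015SAPJoining, §4 (global join plaquettes are few)] -/
def PinchRarity (π : ℝ) : Prop :=
  ∃ C b : ℝ, ∀ i : ℕ,
    pinchMass i ≤ C * ((i : ℝ) + 1) ^ b * (2 : ℝ) ^ (-π * (i : ℝ)) * blockMass term (i + 1)
      + C * (2 : ℝ) ^ (-(4 : ℝ) * (i : ℝ))

/-! ## Audit names of the stub statements -/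

namespace Goal

/-- Statement of stub S2 `stub_dockingEntropy`. -/
abbrev stub_dockingEntropy : Prop := DockingEntropy (5 / 8)

/-- Statement of stub S3 `stub_pinchRarity`. -/
abbrev stub_pinchRarity : Prop := PinchRarity (1 / 2)

end Goal

/-! ## The two OPEN registered stubs (S1 `stub_dockingInjection` and S4 `stub_ledgerBootstrap` are LANDED:
`Theorems/SAWTotalPositivityCriticalBubbleBoundDockingInjection.lean` p76255,
`Theorems/SAWTotalPositivityCriticalBubbleBoundLedgerBootstrap.lean` p73905, imported above) -/

/-- **S2 `stub_dockingEntropy`** (constructive, OPEN). Docking entropy with `κ₀ = 5/8`: for large `i`,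
`c · 2^{-3i/8} · R_i² ≤ dockMass i`. Heuristic `κ' = 13/16` (margin 3/16). No tool in print for fjord
dockings. -/
theorem stub_dockingEntropy : DockingEntropy (5 / 8) := by
  sorry

/-- **S3 `stub_pinchRarity`** (restrictive, OPEN, HARDEST — the lead's stub). Pinch rarity with
`π₀ = 1/2`: `pinchMass i ≤ C (i+1)^b 2^{-i/2} R_{i+1} + C 2^{-4i}`. Heuristic `π' = 11/16` (margin
3/16). In print only `π = 0` for GLOBAL join plaquettes (Hammond 2018 Prop. 4.5). -/
theorem stub_pinchRarity : PinchRarity (1 / 2) := by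
  sorry

/-! ## Glue: the a-priori bound and dyadic regrouping in `ℝ≥0∞` -/

/-- The Hammersley–Welsh a-priori bound for the rooted terms (tree theorem
`Negative.hw_term_upper_bound`). [cite: MadrasSlade1993, §1.4] -/
theorem term_le_exp : ∃ K : ℝ, ∀ n : ℕ, term n ≤ Real.exp (K * Real.sqrt n) := by
  obtain ⟨κ, hκ⟩ := hw_term_upper_bound
  exact ⟨κ, fun n => hκ e₀ n⟩

/-- The bubble-series term in `ℝ≥0∞` is `ofReal (term n)`. [folklore] -/
theorem term_cast (n : ℕ) :
    (Zd.countAt 2 n e₀ : ℝ≥0∞) * ENNReal.ofReal (criticalFugacity ^ n) = ENNReal.ofReal (term n) := by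
  rw [term, ENNReal.ofReal_mul (Nat.cast_nonneg _), ENNReal.ofReal_natCast]

/-- Dyadic regrouping (inequality form): `Σ_n t_n ≤ t_0 + Σ_i R_i` in `ℝ≥0∞`. [folklore] -/
theorem tsum_term_le :
    ∑' n : ℕ, ENNReal.ofReal (term n) ≤
      ENNReal.ofReal (term 0) + ∑' i : ℕ, ENNReal.ofReal (blockMass term i) := by
  classical
  have hpt : ∀ n : ℕ, ENNReal.ofReal (term n) ≤
      (if n = 0 then ENNReal.ofReal (term 0) else 0) +
        ∑' i : ℕ, ((block i : Set ℕ).indicator fun m => ENNReal.ofReal (term m)) n := by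
    intro n
    by_cases hn : n = 0
    · subst hn
      simp only [if_true]
      exact le_self_add
    · rw [if_neg hn, zero_add]
      refine le_trans ?_ (ENNReal.le_tsum (Nat.log 2 n))
      rw [Set.indicator_of_mem (Finset.mem_coe.2 (mem_block_log hn))]
  calc ∑' n : ℕ, ENNReal.ofReal (term n)
      ≤ ∑' n : ℕ, ((if n = 0 then ENNReal.ofReal (term 0) else 0) +
          ∑' i : ℕ, ((block i : Set ℕ).indicator fun m => ENNReal.ofReal (term m)) n) :=
        ENNReal.tsum_le_tsum hpt
    _ = ENNReal.ofReal (term 0) +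
          ∑' n : ℕ, ∑' i : ℕ, ((block i : Set ℕ).indicator fun m => ENNReal.ofReal (term m)) n := by
        rw [ENNReal.tsum_add, tsum_ite_eq]
    _ = ENNReal.ofReal (term 0) +
          ∑' i : ℕ, ∑' n : ℕ, ((block i : Set ℕ).indicator fun m => ENNReal.ofReal (term m)) n := by
        rw [ENNReal.tsum_comm]
    _ = ENNReal.ofReal (term 0) + ∑' i : ℕ, ∑ n ∈ block i, ENNReal.ofReal (term n) := by
        congr 1
        refine tsum_congr fun i => ?_
        rw [sum_eq_tsum_indicator]
    _ = ENNReal.ofReal (term 0) + ∑' i : ℕ, ENNReal.ofReal (blockMass term i) := by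
        congr 1
        refine tsum_congr fun i => ?_
        rw [blockMass, ENNReal.ofReal_sum_of_nonneg fun n _ => term_nonneg n]

/-- Geometric block decay makes the bubble series finite. [folklore] -/
theorem tsum_term_ne_top (h : ∃ C s : ℝ, s < 0 ∧ ∀ i : ℕ, blockMass term i ≤ C * (2 : ℝ) ^ (s * (i : ℝ))) :
    ∑' n : ℕ, (Zd.countAt 2 n e₀ : ℝ≥0∞) * ENNReal.ofReal (criticalFugacity ^ n) ≠ ⊤ := by
  obtain ⟨C, s, hs, hC⟩ := h
  simp_rw [term_cast]
  refine ne_top_of_le_ne_top ?_ tsum_term_le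
  refine ENNReal.add_ne_top.2 ⟨ENNReal.ofReal_ne_top, ?_⟩
  have hC0 : 0 ≤ C := by
    have h0 := hC 0
    simp only [Nat.cast_zero, mul_zero, Real.rpow_zero, mul_one] at h0
    exact le_trans (blockMass_nonneg term_nonneg 0) h0
  have hq0 : 0 ≤ (2 : ℝ) ^ s := Real.rpow_nonneg (by norm_num) s
  have hq1 : (2 : ℝ) ^ s < 1 := Real.rpow_lt_one_of_one_lt_of_neg (by norm_num) hs
  have hpow : ∀ i : ℕ, (2 : ℝ) ^ (s * (i : ℝ)) = ((2 : ℝ) ^ s) ^ i := fun i => by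
    rw [Real.rpow_mul (by norm_num : (0 : ℝ) ≤ 2), Real.rpow_natCast]
  have hsum : Summable fun i : ℕ => C * (2 : ℝ) ^ (s * (i : ℝ)) := by
    simp_rw [hpow]
    exact (summable_geometric_of_lt_one hq0 hq1).mul_left C
  have hnn : ∀ i : ℕ, 0 ≤ C * (2 : ℝ) ^ (s * (i : ℝ)) := fun i =>
    mul_nonneg hC0 (Real.rpow_nonneg (by norm_num) _)
  have hle : ∑' i : ℕ, ENNReal.ofReal (blockMass term i) ≤
      ∑' i : ℕ, ENNReal.ofReal (C * (2 : ℝ) ^ (s * (i : ℝ))) :=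
    ENNReal.tsum_le_tsum fun i => ENNReal.ofReal_le_ofReal (hC i)
  refine ne_top_of_le_ne_top ?_ hle
  rw [← ENNReal.ofReal_tsum_of_nonneg hnn hsum]
  exact ENNReal.ofReal_ne_top

/-! ## The reduction -/

/-- **The composition** (kernel-checked): the two open stubs imply the crux BY NAME, through the
landed S1 (`Docking.stub_dockingInjection`) and S4 (`Docking.stub_ledgerBootstrap`) at
`(κ,π,s) = (5/8, 1/2, -1/16)`, the Hammersley–Welsh a-priori bound, dyadic regrouping and the landed
one-number normal form. -/
theorem CriticalBubbleBound_of_stubs :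
    Goal.stub_dockingEntropy → Goal.stub_pinchRarity →
      _root_.Summit.CriticalPhenomena.SAWScalingLimit.Theses.SAWTotalPositivity.CriticalBubbleBound := by
  intro hS2 hS3
  have hK₁ : 0 < criticalFugacity⁻¹ := inv_pos.2 criticalFugacity_pos_lt_one'.1
  obtain ⟨C, hC⟩ := stub_ledgerBootstrap (5 / 8) (1 / 2) (by norm_num) term dockMass pinchMass
    term_nonneg term_le_exp ⟨criticalFugacity⁻¹, hK₁, stub_dockingInjection⟩
    hS2 hS3 (-1 / 16) (by norm_num) (by norm_num)
  rw [criticalBubbleBound_iff_bubble_e₀_ne_top, bubble, latticeKernel_zero_eq_tsum_countAt]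
  exact tsum_term_ne_top ⟨C, -1 / 16, by norm_num, hC⟩

/-- **`CriticalBubbleBound` from the line `docking-census-joining`**: `_of_stubs` applied to the two
registered (open) stubs. Sorry-free except through `stub_dockingEntropy` / `stub_pinchRarity`. -/
theorem CriticalBubbleBound_of :
    _root_.Summit.CriticalPhenomena.SAWScalingLimit.Theses.SAWTotalPositivity.CriticalBubbleBound :=
  CriticalBubbleBound_of_stubs stub_dockingEntropy stub_pinchRarity

end Summit.CriticalPhenomena.SAWScalingLimit.Cruxes.CriticalBubbleBound.DockingCensusJoining

end
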